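import Summits.KontsevichZagierPeriods.Zeta5Search.Certificates.ModRedLNKTerms
import HarnessLib

/-!
# ζ(5) search — brown9 LEVEL 2 (L-NK): grid slices k₂ ∈ {4,5,6,7} of the packed coordinate check (cell `pub-zeta5`, certifier `cert-2`)

HONEST FRAMING: systematic search; no irrationality claim unless certified.

GENERATED by cert-2 `code/gen_lnk_grid.py`: for each listed integer `k₀` the two-variable packed coordinate combination
`coordGZ β β^{D₁} k₀ …` of (L-NK) vanishes (kernel, big-integer arithmetic; `β = betaG`, `D₁ = 119`). Assembled by
`ModRedLNKKernel` via `PolyReflectCoordGrid.coord_sum_eq_zero_grid`.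
-/

namespace Summit.KontsevichZagierPeriods.Zeta5Search.Certificates

namespace VIMInner.ModRed

open Summit.KontsevichZagierPeriods.Zeta5Search.PolyReflect

set_option maxHeartbeats 100000000 in
/-- Grid slice `k₀ = 4` of the (L-NK) packed coordinate check. -/
theorem sliceM_4 : zIsZero (coordGZ betaG ((betaG ^ 119 : ℕ) : ℤ) 4 ftM
    ((relsM.map lcTrim).map (packLC betaG ((betaG ^ 119 : ℕ) : ℤ) 4)) termsM) = true := by
  decide +kernel

set_option maxHeartbeats 100000000 in
/-- Grid slice `k₀ = 5` of the (L-NK) packed coordinate check. -/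
theorem sliceM_5 : zIsZero (coordGZ betaG ((betaG ^ 119 : ℕ) : ℤ) 5 ftM
    ((relsM.map lcTrim).map (packLC betaG ((betaG ^ 119 : ℕ) : ℤ) 5)) termsM) = true := by
  decide +kernel

set_option maxHeartbeats 100000000 in
/-- Grid slice `k₀ = 6` of the (L-NK) packed coordinate check. -/
theorem sliceM_6 : zIsZero (coordGZ betaG ((betaG ^ 119 : ℕ) : ℤ) 6 ftM
    ((relsM.map lcTrim).map (packLC betaG ((betaG ^ 119 : ℕ) : ℤ) 6)) termsM) = true := by
  decide +kernel

set_option maxHeartbeats 100000000 in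
/-- Grid slice `k₀ = 7` of the (L-NK) packed coordinate check. -/
theorem sliceM_7 : zIsZero (coordGZ betaG ((betaG ^ 119 : ℕ) : ℤ) 7 ftM
    ((relsM.map lcTrim).map (packLC betaG ((betaG ^ 119 : ℕ) : ℤ) 7)) termsM) = true := by
  decide +kernel

end VIMInner.ModRed

end Summit.KontsevichZagierPeriods.Zeta5Search.Certificates
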